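import Mathlib
import HarnessLib
import Summits.ValiantsHypothesis.ValiantsHypothesis.Theorems.LacunarySymmetroidMatrixDescartesProductPlusOneMixedSigned
import Summits.ValiantsHypothesis.ValiantsHypothesis.Theorems.LacunarySymmetroidMatrixDescartesProductPlusOneMixedReverse

/-!
# ValiantsHypothesis / LacunarySymmetroid — crux `MatrixDescartes` (stmt-ValiantsHypothesis-18050, V1),
# LINE (A) «product_plus_one»: signed mixed bound with TOP coupling, and the K = 3 sharp bridge

`mixed_sector_class_signed_top`: the `x ↦ 1/x` mirror (✓ `card_pos_roots_class_reverse`, ✓ `dip_witness_reverse`) of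
✓ `mixed_sector_class_signed` — ratio measured from the top in `[2,4]`, coupling `m·d 2`, every factor no-dip or sharp dip ⇒ `Z₊ ≤ 2m + 2`.
`two_le_card_pos_roots_of_dip_witness`: a trinomial with `a j 0, a j 2 > 0` taking a negative value on `(0,∞)` has at least two positive
zeros (intermediate value theorem on both sides of the witness), so the hypotheses of ✓ `sharp_sector_class` (K = 3) feed
✓ `sharpK_sector_class_signed`: `sharp_sector_class_signed` — K = 3 all-sharp members, ANY support, ANY coupling ⇒ `Z₊ ≤ 2m + 2`.

HONEST FRAMING: sector constants; NOT `stub_classRowK3`, not `stub_polyLaw`, not `ProductPlusOneMDR`, not `MatrixDescartes`, not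
Conjecture B; `VP ≠ VNP` is NOT proved.  No definitions, no named facts.
-/

-- `Summit.ValiantsHypothesis.ValiantsHypothesis.…` is the tree's mandated single-conjunct layout (Sub = Summit).
set_option linter.dupNamespace false

namespace Summit.ValiantsHypothesis.ValiantsHypothesis.Theorems.LacunarySymmetroidMatrixDescartes

namespace ProductPlusOne

open Polynomial Finset
open scoped BigOperators

/-- **THE MIXED SECTOR, SIGN-AWARE, TOP COUPLING**: `d 0 < d 1 < d 2`, `2(d 2 − d 1) ≤ d 2 − d 0 ≤ 4(d 2 − d 1)`, every factor no-dip
or sharp dip ⇒ the member coupled at `m·d 2` has at most `2m + 2` positive zeros. [this file's theorem] -/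
theorem mixed_sector_class_signed_top {m : ℕ} (d : Fin 3 → ℕ) (h01 : d 0 < d 1) (h12 : d 1 < d 2)
    (h2 : 2 * (d 2 - d 1) ≤ d 2 - d 0) (h4 : d 2 - d 0 ≤ 4 * (d 2 - d 1)) (a : Fin m → Fin 3 → ℝ)
    (hfac : ∀ j, a j 0 * a j 2 < 0 ∨
      (0 < a j 0 ∧ 0 < a j 2 ∧ ∃ x₀ : ℝ, 0 < x₀ ∧ a j 0 * x₀ ^ (d 0) + a j 1 * x₀ ^ (d 1) + a j 2 * x₀ ^ (d 2) < 0)) (c : ℝ) :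
    ((C c * X ^ (m * d 2) + ∏ j, ∑ l, C (a j l) * X ^ (d l) : ℝ[X]).roots.toFinset.filter (fun t => 0 < t)).card
      ≤ 2 * m + 2 := by
  have hD : ∀ l : Fin 3, d l ≤ d 2 := by
    intro l
    fin_cases l <;> simp <;> omega
  have hrev := card_pos_roots_class_reverse d (d 2) hD a 2 c
  rw [← hrev, Nat.sub_self, mul_zero]
  have hre : (C c * X ^ 0 + ∏ j, ∑ l, C (a j l) * X ^ (d 2 - d l) : ℝ[X])
      = C c * X ^ (m * (![0, d 2 - d 1, d 2 - d 0] : Fin 3 → ℕ) 0)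
        + ∏ j, ∑ l, C ((fun j l => a j (2 - l)) j l) * X ^ ((![0, d 2 - d 1, d 2 - d 0] : Fin 3 → ℕ) l) := by
    simp only [Matrix.cons_val_zero, mul_zero]
    congr 1
    refine Finset.prod_congr rfl (fun j _ => ?_)
    simp only [Fin.sum_univ_three, Matrix.cons_val_zero, Matrix.cons_val_one, Matrix.head_cons, Matrix.cons_val_two,
      Matrix.tail_cons, Nat.sub_self]
    have e1 : (2 : Fin 3) - 0 = 2 := rfl
    have e2 : (2 : Fin 3) - 1 = 1 := rfl
    have e3 : (2 : Fin 3) - 2 = 0 := rfl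
    rw [e1, e2, e3]
    ring
  rw [hre]
  refine mixed_sector_class_signed (![0, d 2 - d 1, d 2 - d 0]) ?_ ?_ ?_ ?_ (fun j l => a j (2 - l)) ?_ c
  · simp; omega
  · simp; omega
  · simp; omega
  · simp; omega
  · intro j
    have e1 : (2 : Fin 3) - 0 = 2 := rfl
    have e3 : (2 : Fin 3) - 2 = 0 := rfl
    have e2 : (2 : Fin 3) - 1 = 1 := rfl
    simp only [e1, e2, e3]
    rcases hfac j with hac | ⟨ha, hc, x₀, hx₀, hneg⟩
    · left
      rw [mul_comm]
      exact hac
    · right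
      refine ⟨hc, ha, x₀⁻¹, inv_pos.mpr hx₀, ?_⟩
      have hw := dip_witness_reverse d (d 2) hD (a j 0) (a j 1) (a j 2) x₀ hx₀ hneg
      simp only [Matrix.cons_val_zero, Matrix.cons_val_one, Matrix.head_cons, Matrix.cons_val_two, Matrix.tail_cons,
        Nat.sub_self, pow_zero, mul_one] at hw ⊢
      linarith

/-- **Bridge**: a trinomial `Σ_l C (a l) X^{d l}` (`d` strictly increasing) with `a 0, a 2 > 0` and a negative value at some `x₀ > 0`
has at least two distinct positive zeros. [folklore] -/
theorem two_le_card_pos_roots_of_dip_witness (d : Fin 3 → ℕ) (hd : StrictMono d) (a : Fin 3 → ℝ) (h0 : 0 < a 0) (h2 : 0 < a 2)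
    (hwit : ∃ x₀ : ℝ, 0 < x₀ ∧ a 0 * x₀ ^ (d 0) + a 1 * x₀ ^ (d 1) + a 2 * x₀ ^ (d 2) < 0) :
    2 ≤ (((∑ l, C (a l) * X ^ (d l) : ℝ[X])).roots.toFinset.filter (fun t => 0 < t)).card := by
  classical
  obtain ⟨x₀, hx₀, hneg⟩ := hwit
  have h01 : d 0 < d 1 := hd (by decide)
  have h12 : d 1 < d 2 := hd (by decide)
  set f : ℝ[X] := ∑ l, C (a l) * X ^ (d l) with hf
  have hfeval : ∀ x, f.eval x = a 0 * x ^ (d 0) + a 1 * x ^ (d 1) + a 2 * x ^ (d 2) := by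
    intro x; simp [hf, Fin.sum_univ_three]
  have hf0 : f ≠ 0 := by
    intro h
    have := hfeval x₀
    rw [h, eval_zero] at this
    linarith
  -- as an ℕ-indexed sparse sum: sign near 0⁺ is that of a 0, sign near ∞ that of a 2
  set dx : ℕ → ℕ := fun i => if h : i < 3 then d ⟨i, h⟩ else d 2 + (i - 2) with hdx
  set cx : ℕ → ℝ := fun i => if h : i < 3 then a ⟨i, h⟩ else 0 with hcx
  have hdx_in : ∀ i (h : i < 3), dx i = d ⟨i, h⟩ := fun i h => by simp only [hdx]; exact dif_pos h
  have hdmono : StrictMono dx := by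
    intro i j hij
    by_cases hj : j < 3
    · have hi : i < 3 := by omega
      rw [hdx_in i hi, hdx_in j hj]
      exact hd (Fin.mk_lt_mk.mpr hij)
    · have ej : dx j = d 2 + (j - 2) := by simp only [hdx]; exact dif_neg hj
      rw [ej]
      by_cases hi : i < 3
      · rw [hdx_in i hi]
        have : d ⟨i, hi⟩ ≤ d 2 := hd.monotone (Fin.mk_le_of_le_val (by simp; omega))
        omega
      · have ei : dx i = d 2 + (i - 2) := by simp only [hdx]; exact dif_neg hi
        rw [ei]; omega
  have hsum : ∀ x : ℝ, ∑ i ∈ Finset.range (2 + 1), cx i * x ^ (dx i) = f.eval x := by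
    intro x
    rw [hfeval, Finset.sum_range_succ, Finset.sum_range_succ, Finset.sum_range_one]
    simp only [hcx, hdx]
    simp
  obtain ⟨δ, hδ, hsmall⟩ := sparse_sign_near_zero 2 dx hdmono cx (by simp [hcx]; exact h0.ne')
  obtain ⟨xb, hxb, hbig⟩ := sparse_sign_near_top 2 dx hdmono cx (by simp [hcx]; exact h2.ne') x₀
  -- a point left of x₀ with f > 0, and a point right of x₀ with f > 0
  set xs := min x₀ δ / 2 with hxs
  have hxs0 : 0 < xs := by rw [hxs]; positivity
  have hxsδ : xs < δ := by have := min_le_right x₀ δ; rw [hxs]; linarith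
  have hxsx : xs < x₀ := by have := min_le_left x₀ δ; rw [hxs]; linarith
  have hfs : 0 < f.eval xs := by
    have := hsmall xs hxs0 hxsδ
    rw [hsum] at this
    have hc0 : cx 0 = a 0 := by simp [hcx]
    rw [hc0] at this
    exact pos_of_mul_pos_right this h0.le |> fun h => by nlinarith [this, h0]
  have hfb : 0 < f.eval xb := by
    have := hbig
    rw [hsum] at this
    have hc2 : cx 2 = a 2 := by simp [hcx]
    rw [hc2] at this
    nlinarith [this, h2]
  have hfx : f.eval x₀ < 0 := by rw [hfeval]; exact hneg
  -- two roots by IVT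
  obtain ⟨t₁, ht₁, hr₁⟩ := exists_root_of_mul_neg f hxsx (by nlinarith)
  obtain ⟨t₂, ht₂, hr₂⟩ := exists_root_of_mul_neg f hxb (by nlinarith)
  have hmem : ∀ t, 0 < t → f.eval t = 0 → t ∈ f.roots.toFinset.filter (fun s => 0 < s) := by
    intro t ht hft
    rw [mem_filter, Multiset.mem_toFinset, mem_roots hf0]
    exact ⟨hft, ht⟩
  have hne : t₁ ≠ t₂ := by
    intro h
    linarith [ht₁.2, ht₂.1]
  have hsub : ({t₁, t₂} : Finset ℝ) ⊆ f.roots.toFinset.filter (fun s => 0 < s) := by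
    intro t ht
    rw [Finset.mem_insert, Finset.mem_singleton] at ht
    rcases ht with rfl | rfl
    · exact hmem _ (hxs0.trans ht₁.1) hr₁
    · exact hmem _ (hx₀.trans ht₂.1) hr₂
  calc 2 = ({t₁, t₂} : Finset ℝ).card := by rw [Finset.card_pair hne]
    _ ≤ _ := Finset.card_le_card hsub

/-- **THE K = 3 SHARP SECTOR, SIGN-AWARE, ANY SUPPORT, ANY COUPLING**: factors with `a j 0, a j 2 > 0`, each negative somewhere on
`(0,∞)` (the hypotheses of ✓ `sharp_sector_class` plus `StrictMono d`) ⇒ `Z₊ ≤ 2m + 2` (was `4m + 2`). [this file's theorem] -/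
theorem sharp_sector_class_signed {m : ℕ} (d : Fin 3 → ℕ) (hd : StrictMono d) (l₀ : Fin 3) (a : Fin m → Fin 3 → ℝ)
    (hpos : ∀ j, 0 < a j 0 ∧ 0 < a j 2)
    (hwit : ∀ j, ∃ x₀ : ℝ, 0 < x₀ ∧ a j 0 * x₀ ^ (d 0) + a j 1 * x₀ ^ (d 1) + a j 2 * x₀ ^ (d 2) < 0) (c : ℝ) :
    ((C c * X ^ (m * d l₀) + ∏ j, ∑ l, C (a j l) * X ^ (d l) : ℝ[X]).roots.toFinset.filter (fun t => 0 < t)).card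
      ≤ 2 * m + 2 := by
  have hmid : ∀ j, a j 1 ≠ 0 := by
    intro j h
    obtain ⟨x₀, hx₀, hneg⟩ := hwit j
    rw [h, zero_mul, add_zero] at hneg
    have h1 : 0 < a j 0 * x₀ ^ (d 0) := mul_pos (hpos j).1 (pow_pos hx₀ _)
    have h2 : 0 < a j 2 * x₀ ^ (d 2) := mul_pos (hpos j).2 (pow_pos hx₀ _)
    linarith
  have ha : ∀ j l, a j l ≠ 0 := by
    intro j l
    fin_cases l
    · exact (hpos j).1.ne'
    · exact hmid j
    · exact (hpos j).2.ne'
  have hsharp : ∀ j, 3 - 1 ≤ (((∑ l, C (a j l) * X ^ (d l) : ℝ[X])).roots.toFinset.filter (fun t => 0 < t)).card :=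
    fun j => two_le_card_pos_roots_of_dip_witness d hd (a j) (hpos j).1 (hpos j).2 (hwit j)
  have h := sharpK_sector_class_signed (K := 3) (by norm_num) d hd l₀ a ha hsharp c
  simpa using h

end ProductPlusOne

end Summit.ValiantsHypothesis.ValiantsHypothesis.Theorems.LacunarySymmetroidMatrixDescartes
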